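import Mathlib
import HarnessLib
import Summits.HubbardSuperconductivity.HubbardSuperconductivity.Theorems.KLProgrammeKLRegimeEnginePairTransferRelIdxStep
import Summits.HubbardSuperconductivity.HubbardSuperconductivity.Theorems.KLProgrammeKLRegimeEngineV8PairTransferExport5

/-!
# Route `KLProgramme` — ENGINE child gen 8 (stmt-HubbardSuperconductivity-20437 `KLRegimeEngineV17F2`), skeleton v2 stub (X).3 / class #5 rev 3 (Export5, p1b):
# the K5-keyed step and the reduction of `PairTransferStep5` to BASE + STEP — `pairTransferRelFamilyK5_succ_of_pairData`, `pairTransferStep5_of_base_and_succ`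
# (cell gate-hubbard-kl, seat hubbard-kl-k3c1-p1 g11, technique «composed-map remainder propagation»)

WHY.  Stub (X).3 of 20437 v2 asks for `∃ e, IsTransferPkg4 e ∧ PairTransferStep5 P R (klEngQ7 P R) e.1 e.2`; `PairTransferStep5 P R Q₀ r u` (Export5) is the
class-#5 induction step «family `…K5` at every `j < n` ⟹ family at `n`» under the v2 binders.  This file splits that obligation into the two pieces the cell has
owners for and keys the step piece on the doors of this lineage:
* **`pairTransferRelFamilyK5_succ_of_pairData`** — `PairTransferRelFamilyK5 … n → PairTransferRelFamilyK5 … (n+1)` from `Z^{K_{n+1}} ≠ 0` on the slice and, per pair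
  `(s_{n+1,j} | s_{n+1,j′})` and pair class, the SIZES bundle of `pairTransferRelAt_succ_keyed` (`…EnginePairTransferRelIdxStep`: member flow + start re-frame by name)
  — literally `pairTransferRelIdx_family_succ` read through Export5's definition;
* **`pairTransferStep5_of_base_and_succ`** — `PairTransferStep5 P R Q₀ r u` from (BASE) the family at `n = 0` under the v2 binders (k3c2-p1 lineage, scale-0 analysis)
  and (STEP) `…K5 n → …K5 (n+1)` under the v2 binders at `n+1` (this lineage's `pairTransferRelFamilyK5_succ_of_pairData` once the analytic sizes are supplied) — the
  `∀ j < n` history is read at `j = n` only (case split on `n`).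
Plumbing only; nothing about the model's sizes is asserted; nothing asserts any stub, K3 or superconductivity.  0 kit.
-/

noncomputable section

namespace Summit.HubbardSuperconductivity.HubbardSuperconductivity.Theorems.KLRegimeSplit

set_option linter.dupNamespace false -- summit = problem name (single-conjunct summit), D-0017

open Finset Matrix Set Literature.MathematicalPhysics.QuantumLattice Literature.Probability.LatticeModels GrassmannAlgebra
open Literature.MathematicalPhysics.QuantumLattice.FermiRG
open Summit.HubbardSuperconductivity.HubbardSuperconductivity.Theorems.KLProgrammeLegKernels
open Summit.HubbardSuperconductivity.HubbardSuperconductivity.Theorems.DispersionFlow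
open Summit.HubbardSuperconductivity.HubbardSuperconductivity.Theorems.KLRegimeWick
open Summit.HubbardSuperconductivity.HubbardSuperconductivity.Theorems.EngineV8

/-! ## §1 The K5-keyed step -/

section K5

variable (L M : ℕ) [NeZero L] [NeZero M]

/-- Export5's family IS the index clause (unfolding; `Iff.rfl`). -/
theorem pairTransferRelFamilyK5_iff_idx (G : GeoConsts) (P : SplitConsts) (r β U μ : ℝ) (n : ℕ) :
    PairTransferRelFamilyK5 L M G P r β U μ n ↔
      ∀ m m' : ℕ, n ≤ m' → m' ≤ m → m ≤ nScales β + 1 →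
        PairTransferRelAt L M β U μ n (transferBarRelIdx L G P r β U n m')
          (softSymbolCompl L M β μ (klFlowFrameU L M β U μ n) n m) (softSymbolCompl L M β μ (klFlowFrameU L M β U μ n) n m') := Iff.rfl

set_option maxHeartbeats 1600000 in -- very long hypothesis bundle; plumbing
/-- **`pairTransferRelFamilyK5_succ_of_pairData`** — Export5's family at `n+1` from the family at `n`, `Z^{K_{n+1}} ≠ 0` on the slice, and per pair / pair class the SIZES
bundle of `pairTransferRelAt_succ_keyed` on the member-indexed curves (see `…EnginePairTransferRelIdxStep`). -/
theorem pairTransferRelFamilyK5_succ_of_pairData {G : GeoConsts} {P : SplitConsts} {r β U μ : ℝ} {n : ℕ} {mA : ℝ} (hm : 0 ≤ mA)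
    (hZ : ∀ Λ ∈ Icc (klScale klE0 (n + 1)) (klScale klE0 n), hubbardEffPartitionFnCT L M β U μ 0 (klFlowFrameU L M β U μ (n + 1)) Λ ≠ 0)
    (A A' : ℕ → TorusSite 2 L → ℝ → Matrix (TorusSite 2 L) (TorusSite 2 L) ℂ) (b b' : ℕ → TorusSite 2 L → ℝ → TorusSite 2 L → ℂ)
    (a : ℕ → ℕ → TorusSite 2 L → ℝ → TorusSite 2 L → ℂ)
    (hAdef : A = fun j Qm t => Matrix.of fun k k' : TorusSite 2 L => if k ∈ klBall L μ 0 ∧ k' ∈ klBall L μ 0 then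
      vertexFn L M β (gaussConv ℂ
        (softCovOf L M β μ (klFlowFrameU L M β U μ (n + 1)) (softSymbolCompl L M β μ (klFlowFrameU L M β U μ (n + 1)) (n + 1) j) + hubbardCovAboveCT L M β μ 0 (klFlowFrameU L M β U μ (n + 1)) (klScale klE0 (n + 1)) -
          hubbardCovAboveCT L M β μ 0 (klFlowFrameU L M β U μ (n + 1)) (klScale klE0 n + t * (klScale klE0 (n + 1) - klScale klE0 n)))
        (hubbardEffectiveActionCT L M β U μ 0 (klFlowFrameU L M β U μ (n + 1)) (klScale klE0 n + t * (klScale klE0 (n + 1) - klScale klE0 n)))) 4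
        ![(((omega0 M, k'), 0), 0), ((((omega0 M).rev, Qm - k'), 1), 0), ((((omega0 M).rev, Qm - k), 1), 1), (((omega0 M, k), 0), 1)]
      else 0)
    (hA'def : A' = fun j Qm t => Matrix.of fun k k' : TorusSite 2 L => if k ∈ klBall L μ 0 ∧ k' ∈ klBall L μ 0 then
      (klScale klE0 (n + 1) - klScale klE0 n) • -((2 : ℂ)⁻¹ * vertexFn L M β (gaussConv ℂ
        (softCovOf L M β μ (klFlowFrameU L M β U μ (n + 1)) (softSymbolCompl L M β μ (klFlowFrameU L M β U μ (n + 1)) (n + 1) j) + hubbardCovAboveCT L M β μ 0 (klFlowFrameU L M β U μ (n + 1)) (klScale klE0 (n + 1)) -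
          hubbardCovAboveCT L M β μ 0 (klFlowFrameU L M β U μ (n + 1)) (klScale klE0 n + t * (klScale klE0 (n + 1) - klScale klE0 n)))
        (grassmannDerivPairing ℂ
          (Matrix.of fun X Y : HubbardFieldIdx L M => deriv (fun Λ'' : ℝ => hubbardCovAboveCT L M β μ 0 (klFlowFrameU L M β U μ (n + 1)) Λ'' X Y)
            (klScale klE0 n + t * (klScale klE0 (n + 1) - klScale klE0 n)))
          (hubbardEffectiveActionCT L M β U μ 0 (klFlowFrameU L M β U μ (n + 1)) (klScale klE0 n + t * (klScale klE0 (n + 1) - klScale klE0 n)))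
          (hubbardEffectiveActionCT L M β U μ 0 (klFlowFrameU L M β U μ (n + 1)) (klScale klE0 n + t * (klScale klE0 (n + 1) - klScale klE0 n))))) 4
        ![(((omega0 M, k'), 0), 0), ((((omega0 M).rev, Qm - k'), 1), 0), ((((omega0 M).rev, Qm - k), 1), 1), (((omega0 M, k), 0), 1)])
      else 0)
    (hbdef : b = fun j Qm t p => -((klBubbleMass L M β μ (klFlowFrameU L M β U μ (n + 1))
        (fun k => (softSymbolCompl L M β μ (klFlowFrameU L M β U μ (n + 1)) (n + 1) j) k + (hubbardCutoffWeightCT L M β μ (klFlowFrameU L M β U μ (n + 1)) (klScale klE0 (n + 1)) k -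
          hubbardCutoffWeightCT L M β μ (klFlowFrameU L M β U μ (n + 1)) (klScale klE0 n + t * (klScale klE0 (n + 1) - klScale klE0 n)) k))
        (fun k => (softSymbolCompl L M β μ (klFlowFrameU L M β U μ (n + 1)) (n + 1) j) k + (hubbardCutoffWeightCT L M β μ (klFlowFrameU L M β U μ (n + 1)) (klScale klE0 (n + 1)) k -
          hubbardCutoffWeightCT L M β μ (klFlowFrameU L M β U μ (n + 1)) (klScale klE0 n + t * (klScale klE0 (n + 1) - klScale klE0 n)) k)) Qm p : ℝ) : ℂ))
    (hb'def : b' = fun j Qm t p => (((klScale klE0 (n + 1) - klScale klE0 n) *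
        (klBubbleMass L M β μ (klFlowFrameU L M β U μ (n + 1))
            (fun k => deriv (fun Λ' => hubbardCutoffWeightCT L M β μ (klFlowFrameU L M β U μ (n + 1)) Λ' k) (klScale klE0 n + t * (klScale klE0 (n + 1) - klScale klE0 n)))
            (fun k => (softSymbolCompl L M β μ (klFlowFrameU L M β U μ (n + 1)) (n + 1) j) k + (hubbardCutoffWeightCT L M β μ (klFlowFrameU L M β U μ (n + 1)) (klScale klE0 (n + 1)) k -
          hubbardCutoffWeightCT L M β μ (klFlowFrameU L M β U μ (n + 1)) (klScale klE0 n + t * (klScale klE0 (n + 1) - klScale klE0 n)) k)) Qm p +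
          klBubbleMass L M β μ (klFlowFrameU L M β U μ (n + 1))
            (fun k => (softSymbolCompl L M β μ (klFlowFrameU L M β U μ (n + 1)) (n + 1) j) k + (hubbardCutoffWeightCT L M β μ (klFlowFrameU L M β U μ (n + 1)) (klScale klE0 (n + 1)) k -
          hubbardCutoffWeightCT L M β μ (klFlowFrameU L M β U μ (n + 1)) (klScale klE0 n + t * (klScale klE0 (n + 1) - klScale klE0 n)) k))
            (fun k => deriv (fun Λ' => hubbardCutoffWeightCT L M β μ (klFlowFrameU L M β U μ (n + 1)) Λ' k) (klScale klE0 n + t * (klScale klE0 (n + 1) - klScale klE0 n)))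
            Qm p) : ℝ) : ℂ))
    (hadef : a = fun j j' Qm t p => (b j Qm t p - b j' Qm t p) +
      (-(((klTransferWeight L M β μ (klFlowFrameU L M β U μ (n + 1)) (n + 1) (softSymbolCompl L M β μ (klFlowFrameU L M β U μ (n + 1)) (n + 1) j) Qm p -
          klTransferWeight L M β μ (klFlowFrameU L M β U μ (n + 1)) (n + 1) (softSymbolCompl L M β μ (klFlowFrameU L M β U μ (n + 1)) (n + 1) j') Qm p : ℝ)) : ℂ) -
        (b j Qm 1 p - b j' Qm 1 p)))
    (hhist : PairTransferRelFamilyK5 L M G P r β U μ n)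
    (hdata : ∀ j j' : ℕ, n + 1 ≤ j' → j' ≤ j → j ≤ nScales β + 1 → ∀ Qm : TorusSite 2 L, IsPairClassAt L Qm (n + 1) →
      ∃ (ρ₁ ρ₂ : TorusSite 2 L → ℝ) (ηr η₁ η₂ T₀ R₀ I S T : TorusSite 2 L → TorusSite 2 L → ℝ) (d : TorusSite 2 L → ℝ) (β' δ ξ ξ₁ ξ₂ : ℝ),
        0 ≤ δ ∧ 0 ≤ ξ ∧ 0 ≤ ξ₁ ∧ 0 ≤ ξ₂ ∧
        -- a priori sizes of the two member arrays, rates, profiles, smallness, Riccati-defect sups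
        (∀ t ∈ Icc (0 : ℝ) 1, ∀ x y, ‖A j Qm t x y‖ ≤ mA) ∧ (∀ t ∈ Icc (0 : ℝ) 1, ∀ x y, ‖A j' Qm t x y‖ ≤ mA) ∧
        (∀ t ∈ Icc (0 : ℝ) 1, ∑ c, ‖b' j Qm t c‖ ≤ β') ∧ (∀ t ∈ Icc (0 : ℝ) 1, ∑ c, ‖b' j' Qm t c‖ ≤ β') ∧
        (∀ t ∈ Icc (0 : ℝ) 1, ∀ c, ‖b j Qm t c - b j Qm 0 c‖ ≤ ρ₁ c) ∧ (∀ t ∈ Icc (0 : ℝ) 1, ∀ c, ‖b j' Qm t c - b j' Qm 0 c‖ ≤ ρ₂ c) ∧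
        mA * β' ≤ 1 / 3 ∧ mA * ∑ c, ρ₁ c ≤ 1 / 3 ∧ mA * ∑ c, ρ₂ c ≤ 1 / 3 ∧
        (∀ t ∈ Icc (0 : ℝ) 1, ∀ x y, ‖(A' j Qm t + A j Qm t * diagonal (b' j Qm t) * A j Qm t) x y‖ ≤ ξ₁) ∧
        (∀ t ∈ Icc (0 : ℝ) 1, ∀ x y, ‖(A' j' Qm t + A j' Qm t * diagonal (b' j' Qm t) * A j' Qm t) x y‖ ≤ ξ₂) ∧
        -- the history arrays' a priori size and the START RE-FRAME majorants ((F)(i) lane) against the history objects at frame `K_n`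
        (∀ x y, ‖klMemberArrayF L M β U μ n (softSymbolCompl L M β μ (klFlowFrameU L M β U μ n) n j) Qm x y‖ ≤ mA) ∧ (∀ x y, ‖klMemberArrayF L M β U μ n (softSymbolCompl L M β μ (klFlowFrameU L M β U μ n) n j') Qm x y‖ ≤ mA) ∧
        (∀ x y, ‖((A j Qm 0 - klMemberArrayF L M β U μ n (softSymbolCompl L M β μ (klFlowFrameU L M β U μ n) n j) Qm) - (A j' Qm 0 - klMemberArrayF L M β U μ n (softSymbolCompl L M β μ (klFlowFrameU L M β U μ n) n j') Qm)) x y‖ ≤ ηr x y) ∧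
        (∀ x y, ‖(A j Qm 0 - klMemberArrayF L M β U μ n (softSymbolCompl L M β μ (klFlowFrameU L M β U μ n) n j) Qm) x y‖ ≤ η₁ x y) ∧
        (∀ x y, ‖(A j' Qm 0 - klMemberArrayF L M β U μ n (softSymbolCompl L M β μ (klFlowFrameU L M β U μ n) n j') Qm) x y‖ ≤ η₂ x y) ∧
        (∀ c, ‖a j j' Qm 0 c - -(((klTransferWeight L M β μ (klFlowFrameU L M β U μ n) n (softSymbolCompl L M β μ (klFlowFrameU L M β U μ n) n j) Qm c -
            klTransferWeight L M β μ (klFlowFrameU L M β U μ n) n (softSymbolCompl L M β μ (klFlowFrameU L M β U μ n) n j') Qm c : ℝ)) : ℂ)‖ ≤ d c) ∧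
        mA * ∑ c, ‖a j j' Qm 0 c‖ ≤ 1 / 3 ∧
        (∀ x y, ((if x ∈ klBall L μ 0 ∧ y ∈ klBall L μ 0 then transferBarRelIdx L G P r β U n j' Qm x y else 0) +
            ∑ c, (if x ∈ klBall L μ 0 ∧ c ∈ klBall L μ 0 then transferBarRelIdx L G P r β U n j' Qm x c else 0) *
              ‖(-(((klTransferWeight L M β μ (klFlowFrameU L M β U μ n) n (softSymbolCompl L M β μ (klFlowFrameU L M β U μ n) n j) Qm c -
            klTransferWeight L M β μ (klFlowFrameU L M β U μ n) n (softSymbolCompl L M β μ (klFlowFrameU L M β U μ n) n j') Qm c : ℝ)) : ℂ))‖ * mA) +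
            ηr x y + mA * ∑ c, η₁ x c * ‖a j j' Qm 0 c‖ + mA * mA * ∑ c, d c +
            mA * ∑ c, ‖(-(((klTransferWeight L M β μ (klFlowFrameU L M β U μ n) n (softSymbolCompl L M β μ (klFlowFrameU L M β U μ n) n j) Qm c -
            klTransferWeight L M β μ (klFlowFrameU L M β U μ n) n (softSymbolCompl L M β μ (klFlowFrameU L M β U μ n) n j') Qm c : ℝ)) : ℂ))‖ * η₂ c y ≤ T₀ x y) ∧
        (∀ x y, T₀ x y + ∑ c, T₀ x c * ‖a j j' Qm 0 c‖ * (3 / 2 * mA) ≤ R₀ x y) ∧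
        (∀ x y, R₀ x y + ∑ c, R₀ x c * ‖a j j' Qm 0 c‖ * mA ≤ δ) ∧
        -- the RELATIVE source (sup and slice integral), the intermediate majorants, endpoint smallness, the budget line
        (∀ t ∈ Icc (0 : ℝ) 1, ∀ x y, ‖((A' j Qm t + A j Qm t * diagonal (b' j Qm t) * A j Qm t) * (1 + diagonal (a j j' Qm t) * A j' Qm t) +
            A j Qm t * diagonal (a j j' Qm t) * (A' j' Qm t + A j' Qm t * diagonal (b' j' Qm t) * A j' Qm t) - (A' j' Qm t + A j' Qm t * diagonal (b' j' Qm t) * A j' Qm t)) x y‖ ≤ ξ) ∧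
        (∀ x y, (∫ t in (0 : ℝ)..1, ‖((A' j Qm t + A j Qm t * diagonal (b' j Qm t) * A j Qm t) * (1 + diagonal (a j j' Qm t) * A j' Qm t) +
            A j Qm t * diagonal (a j j' Qm t) * (A' j' Qm t + A j' Qm t * diagonal (b' j' Qm t) * A j' Qm t) - (A' j' Qm t + A j' Qm t * diagonal (b' j' Qm t) * A j' Qm t)) x y‖) ≤ I x y) ∧
        (∀ x y, (R₀ x y + ∑ c, R₀ x c * ‖a j j' Qm 0 c‖ * mA) +
            (I x y + ∑ c, I x c * ρ₂ c * mA + ∑ a', mA * ρ₁ a' * I a' y + ∑ a', ∑ c, mA * ρ₁ a' * I a' c * ρ₂ c * mA) +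
            4 / 3 * (δ * Real.exp (mA * β' + mA * β') + 2 * ξ) * β' * (8 / 3 * ξ₁ + 8 / 3 * ξ₂) ≤ S x y) ∧
        (∀ x y, S x y + ∑ c, S x c * ρ₂ c * (3 / 2 * mA) + ∑ a', 3 / 2 * mA * ρ₁ a' * S a' y +
            ∑ a', ∑ c, 3 / 2 * mA * ρ₁ a' * S a' c * ρ₂ c * (3 / 2 * mA) ≤ T x y) ∧
        mA * ∑ c, ‖a j j' Qm 1 c‖ ≤ 1 / 3 ∧
        (∀ k ∈ klBall L μ 0, ∀ k' ∈ klBall L μ 0, T k k' + ∑ c, T k c * ‖a j j' Qm 1 c‖ * (3 / 2 * mA) ≤ transferBarRelIdx L G P r β U (n + 1) j' Qm k k')) :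
    PairTransferRelFamilyK5 L M G P r β U μ (n + 1) :=
  pairTransferRelIdx_family_succ L M hm hZ A A' b b' a hAdef hA'def hbdef hb'def hadef hhist hdata

end K5

/-! ## §2 `PairTransferStep5` = BASE + STEP -/

section Step5

/-- **`pairTransferStep5_of_base_and_succ`** — the (X).3 class-#5 step from a BASE clause (the family at `n = 0` under the v2 binders) and a STEP clause
(`…K5 n → …K5 (n+1)` under the v2 binders at `n+1`).  Both clauses carry PairTransferStep5's binder list verbatim at their scale. -/
theorem pairTransferStep5_of_base_and_succ {P : SplitConsts} {R : RenConsts} {Q₀ : EngConsts} {r : ℝ} {u : EngConsts → ℝ → ℝ}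
    (hbase : ∀ G : GeoConsts, G.WF → ∀ Q : EngConsts, Q₀.IsRaiseOf Q →
      ∀ cc : ℝ, 0 < cc → cc ≤ klEngC₃6 P R →
        ∀ μ ∈ klWindowC, ∀ U : ℝ, 0 < U → U ≤ klEngU₀10 P R cc → U ≤ u Q cc →
          ∀ β : ℝ, klBetaMin ≤ β → β ≤ Real.exp (cc / U ^ 2) →
            ∀ (L M : ℕ) [NeZero L] [NeZero M], klEngL₄ P R β U ≤ L → klEngM₃ β U L ≤ M →
              0 ≤ nScales β + 1 → IsKLRegime U cc (-((0 : ℕ) : ℤ)) →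
                HistP klPredsV17F2 L M G P Q R β U μ 0 0 →
                  FrameOK R U (nScales β) μ (klFlowFrameU L M β U μ 0) →
                    (∀ j ≤ 0, LevelsUExportMixedAt L M (klCU2 P R Q₀) P β U μ j) →
                      PairTransferRelFamilyK5 L M G P r β U μ 0)
    (hsucc : ∀ G : GeoConsts, G.WF → ∀ Q : EngConsts, Q₀.IsRaiseOf Q →
      ∀ cc : ℝ, 0 < cc → cc ≤ klEngC₃6 P R →
        ∀ μ ∈ klWindowC, ∀ U : ℝ, 0 < U → U ≤ klEngU₀10 P R cc → U ≤ u Q cc →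
          ∀ β : ℝ, klBetaMin ≤ β → β ≤ Real.exp (cc / U ^ 2) →
            ∀ (L M : ℕ) [NeZero L] [NeZero M], klEngL₄ P R β U ≤ L → klEngM₃ β U L ≤ M →
              ∀ n : ℕ, n + 1 ≤ nScales β + 1 → IsKLRegime U cc (-((n + 1 : ℕ) : ℤ)) →
                HistP klPredsV17F2 L M G P Q R β U μ 0 (n + 1) →
                  FrameOK R U (nScales β) μ (klFlowFrameU L M β U μ (n + 1)) →
                    (∀ j ≤ n + 1, LevelsUExportMixedAt L M (klCU2 P R Q₀) P β U μ j) →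
                      PairTransferRelFamilyK5 L M G P r β U μ n → PairTransferRelFamilyK5 L M G P r β U μ (n + 1)) :
    PairTransferStep5 P R Q₀ r u := by
  intro G hG Q hQ cc hcc0 hcc μ hμ U hU hU10 hUu β hβ hβc L M _ _ hL hM n hn hreg hhist hK hlev hfam
  cases n with
  | zero => exact hbase G hG Q hQ cc hcc0 hcc μ hμ U hU hU10 hUu β hβ hβc L M hL hM hn hreg hhist hK hlev
  | succ n => exact hsucc G hG Q hQ cc hcc0 hcc μ hμ U hU hU10 hUu β hβ hβc L M hL hM n hn hreg hhist hK hlev (hfam n (Nat.lt_succ_self n))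

end Step5

end Summit.HubbardSuperconductivity.HubbardSuperconductivity.Theorems.KLRegimeSplit

end
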